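import Literature.Geometry.Lorentzian.ChartLaplacian
import Literature.Geometry.Lorentzian.SecondFundamentalFormSymm
import Literature.Geometry.Riemannian.MaximumPrincipleAtMaxima
import Literature.Topology.FourManifolds.MorseExtrema
import HarnessLib

/-!
# The covariant Hessian and the Laplacian at an interior local maximum

The second-derivative test on a (pseudo-)Riemannian manifold without boundary: at a local
maximum `x` of a function `f` of class `C²`, the covariant Hessian `Hess f (x)` is negative
semidefinite, and — when `g_x` is positive definite — the Laplace–Beltrami operator satisfies
`Δ_g f (x) = tr_g Hess f (x) ≤ 0`. This is the pointwise form of the maximum principle used by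
Schoen–Yau, Comm. Math. Phys. 65 (1979), §2, p. 51 (the height estimate (2.5): "contradicting
the fact that `x³` attains a maximum there") and by every tangency / barrier argument.

Proof: on the coordinate frame `∂ᵢ` of the chart at `x` (which at `x` is the reference basis
`bᵢ`, `localFrame_trivializationAt_self`) the Hessian is
`Hess f(∂ᵢ, ∂ⱼ)(x) = ∂ᵢ∂ⱼ f̂ − Σₗ Γˡᵢⱼ ∂ₗ f̂` (`hessian_localFrame`, O'Neill 1983, Ch. 3,
Lemma 3.49), the first-order term vanishes at the critical point (`IsLocalMax.fderiv_eq_zero` for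
the chart representative `f̂`), and `D²f̂(x̂)(w, w) ≤ 0` at the local maximum `x̂` of `f̂`
(`IsLocalMax.fderiv_fderiv_apply_self_nonpos`, `MorseExtrema.lean`); the two bilinear forms
agree on a basis, hence everywhere. The trace statement is
`trace_nonpos_of_forall_apply_self_nonpos` (`MaximumPrincipleAtMaxima.lean`).

* `PseudoRiemannianMetric.hessian_eq_fderiv_fderiv_of_isLocalMax` — at a local maximum the
  covariant Hessian is the chart Hessian of the chart representative.
* `PseudoRiemannianMetric.hessian_apply_self_nonpos_of_isLocalMax` — `Hess f (x)(v, v) ≤ 0`.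
* `PseudoRiemannianMetric.dalembertian_nonpos_of_isLocalMax` — `Δ_g f (x) ≤ 0` if `g_x > 0`.
* the mirror statements at a local minimum.

Everything is proved; no named fact and no `sorry` is introduced.

## References

* B. O'Neill, *Semi-Riemannian geometry*, Academic Press (1983), Ch. 3, Lemma 3.49–Def. 3.50.
  [ONeill1983]
* R. Schoen, S.-T. Yau, *On the proof of the positive mass conjecture in general relativity*,
  Comm. Math. Phys. 65 (1979), 45–76, §2, p. 51. [SchoenYauPMT1979]
-/

noncomputable section

open Bundle Set Function Filter
open scoped Manifold ContDiff Topology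

namespace Literature.Geometry.Lorentzian

namespace PseudoRiemannianMetric

variable {E : Type*} [NormedAddCommGroup E] [NormedSpace ℝ E] {H : Type*} [TopologicalSpace H]
  {I : ModelWithCorners ℝ E H} {M : Type*} [TopologicalSpace M] [ChartedSpace H M]
  [IsManifold I ∞ M] [FiniteDimensional ℝ E] [CompleteSpace E] [I.Boundaryless]
  (g : PseudoRiemannianMetric I ∞ E (TangentSpace I : M → Type _)) [g.HasLeviCivita]

omit [IsManifold I ∞ M] [FiniteDimensional ℝ E] [CompleteSpace E] [I.Boundaryless] in
/-- The chart representative `writtenInExtChartAt I 𝓘(ℝ, ℝ) x f` of a real function is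
`f ∘ (extChartAt I x).symm`. [folklore] -/
theorem writtenInExtChartAt_real_apply (f : M → ℝ) (x : M) (z : E) :
    writtenInExtChartAt I 𝓘(ℝ, ℝ) x f z = f ((extChartAt I x).symm z) := by
  simp only [writtenInExtChartAt, extChartAt_model_space_eq_id, PartialEquiv.refl_coe,
    Function.comp_apply, id_eq]

/-- **At a critical point the covariant Hessian is the chart Hessian**: if `D f̂ (x̂) = 0` for
the chart representative `f̂ = f ∘ (extChartAt I x)⁻¹` at `x̂ = extChartAt I x x`, then
`Hess_g f (x)(v, w) = D²f̂(x̂)(v, w)` (the Christoffel term of O'Neill 1983, Ch. 3, Lemma 3.49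
drops out). [cite: ONeill1983, Ch. 3, Lemma 3.49] -/
theorem hessian_eq_fderiv_fderiv_of_fderiv_eq_zero {f : M → ℝ} {x : M}
    (hf : ContMDiffAt I 𝓘(ℝ, ℝ) 2 f x)
    (hcrit : fderiv ℝ (writtenInExtChartAt I 𝓘(ℝ, ℝ) x f) (extChartAt I x x) = 0)
    (v w : TangentSpace I x) :
    g.hessian f x v w =
      fderiv ℝ (fderiv ℝ (writtenInExtChartAt I 𝓘(ℝ, ℝ) x f)) (extChartAt I x x) v w := by
  classical
  set b : Module.Basis (Fin (Module.finrank ℝ E)) ℝ E := Module.finBasis ℝ E with hb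
  have hx : x ∈ (chartAt H x).source := mem_chart_source H x
  have hframe : ∀ i, (trivializationAt E (TangentSpace I) x).localFrame b i x = b i :=
    fun i ↦ localFrame_trivializationAt_self b x i
  have hfh : writtenInExtChartAt I 𝓘(ℝ, ℝ) x f =ᶠ[𝓝 (extChartAt I x x)]
      f ∘ (extChartAt I x).symm :=
    Filter.Eventually.of_forall fun z ↦ writtenInExtChartAt_real_apply f x z
  -- the Hessian on the coordinate frame
  have hij : ∀ i j, g.hessian f x (b i) (b j) =
      fderiv ℝ (fderiv ℝ (writtenInExtChartAt I 𝓘(ℝ, ℝ) x f)) (extChartAt I x x) (b i) (b j) := by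
    intro i j
    have h := hessian_localFrame g b hx hf
      (Gh := fun z i j ↦ g.val ((extChartAt I x).symm z)
        ((trivializationAt E (TangentSpace I) x).localFrame b i ((extChartAt I x).symm z))
        ((trivializationAt E (TangentSpace I) x).localFrame b j ((extChartAt I x).symm z)))
      (Filter.Eventually.of_forall fun z i j ↦ rfl) hfh i j
    rw [hframe i, hframe j] at h
    rw [h, hcrit]
    simp
  -- extend by bilinearity from the basis
  set B₂ : LinearMap.BilinForm ℝ (TangentSpace I x) :=
    (ContinuousLinearMap.coeLM ℝ).comp
      (fderiv ℝ (fderiv ℝ (writtenInExtChartAt I 𝓘(ℝ, ℝ) x f)) (extChartAt I x x)).toLinearMap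
    with hB₂
  have hB₂a : ∀ v w, B₂ v w =
      fderiv ℝ (fderiv ℝ (writtenInExtChartAt I 𝓘(ℝ, ℝ) x f)) (extChartAt I x x) v w :=
    fun v w ↦ rfl
  have heq : g.hessian f x = B₂ := by
    refine LinearMap.BilinForm.ext_basis (b := (b : Module.Basis _ ℝ (TangentSpace I x)))
      fun i j ↦ ?_
    exact hij i j
  rw [heq, hB₂a]

/-- **The covariant Hessian at a local maximum is negative semidefinite** (manifold without
boundary, `f` of class `C²` at the point): `Hess_g f (x)(v, v) ≤ 0`. The step "`x³` attains a
maximum there" of Schoen–Yau 1979, p. 51. [cite: SchoenYauPMT1979, §2 Step 2, p. 51]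
[cite: ONeill1983, Ch. 3, Lemma 3.49] -/
theorem hessian_apply_self_nonpos_of_isLocalMax {f : M → ℝ} {x : M}
    (hf : ContMDiffAt I 𝓘(ℝ, ℝ) 2 f x) (hmax : IsLocalMax f x) (v : TangentSpace I x) :
    g.hessian f x v v ≤ 0 := by
  have hmax' := Literature.Topology.FourManifolds.isLocalMax_writtenInExtChartAt (I := I) hmax
  have h2 : ContDiffAt ℝ 2 (writtenInExtChartAt I 𝓘(ℝ, ℝ) x f) (extChartAt I x x) := by
    have := (contMDiffAt_iff.1 hf).2
    rwa [ModelWithCorners.Boundaryless.range_eq_univ, contDiffWithinAt_univ] at this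
  rw [g.hessian_eq_fderiv_fderiv_of_fderiv_eq_zero hf hmax'.fderiv_eq_zero v v]
  exact Literature.Topology.FourManifolds.IsLocalMax.fderiv_fderiv_apply_self_nonpos h2 hmax' v

/-- **The covariant Hessian at a local minimum is positive semidefinite.**
[cite: ONeill1983, Ch. 3, Lemma 3.49] -/
theorem hessian_apply_self_nonneg_of_isLocalMin {f : M → ℝ} {x : M}
    (hf : ContMDiffAt I 𝓘(ℝ, ℝ) 2 f x) (hmin : IsLocalMin f x) (v : TangentSpace I x) :
    0 ≤ g.hessian f x v v := by
  have hmin' := Literature.Topology.FourManifolds.isLocalMin_writtenInExtChartAt (I := I) hmin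
  have h2 : ContDiffAt ℝ 2 (writtenInExtChartAt I 𝓘(ℝ, ℝ) x f) (extChartAt I x x) := by
    have := (contMDiffAt_iff.1 hf).2
    rwa [ModelWithCorners.Boundaryless.range_eq_univ, contDiffWithinAt_univ] at this
  rw [g.hessian_eq_fderiv_fderiv_of_fderiv_eq_zero hf hmin'.fderiv_eq_zero v v]
  exact Literature.Topology.FourManifolds.IsLocalMin.fderiv_fderiv_apply_self_nonneg h2 hmin' v

/-- **`Δ_g f ≤ 0` at an interior local maximum** when `g_x` is positive definite (e.g. `g`
Riemannian): `Δ_g f (x) = tr_g Hess_g f (x)` is a sum of values `Hess f (eₐ, eₐ) ≤ 0` over an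
orthonormal basis. Schoen–Yau 1979, p. 51. [cite: SchoenYauPMT1979, §2 Step 2, p. 51]
[cite: ONeill1983, Ch. 3, Def. 3.50] -/
theorem dalembertian_nonpos_of_isLocalMax {f : M → ℝ} {x : M}
    (hf : ContMDiffAt I 𝓘(ℝ, ℝ) 2 f x) (hmax : IsLocalMax f x)
    (hpos : ∀ v : TangentSpace I x, v ≠ 0 → 0 < g.val x v v) :
    g.dalembertian f x ≤ 0 :=
  Literature.Geometry.Riemannian.trace_nonpos_of_forall_apply_self_nonpos g hpos _
    fun v ↦ g.hessian_apply_self_nonpos_of_isLocalMax hf hmax v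

/-- **`Δ_g f ≥ 0` at an interior local minimum** when `g_x` is positive definite.
[cite: ONeill1983, Ch. 3, Def. 3.50] -/
theorem dalembertian_nonneg_of_isLocalMin {f : M → ℝ} {x : M}
    (hf : ContMDiffAt I 𝓘(ℝ, ℝ) 2 f x) (hmin : IsLocalMin f x)
    (hpos : ∀ v : TangentSpace I x, v ≠ 0 → 0 < g.val x v v) :
    0 ≤ g.dalembertian f x :=
  Literature.Geometry.Riemannian.trace_nonneg_of_forall_apply_self_nonneg g hpos _
    fun v ↦ g.hessian_apply_self_nonneg_of_isLocalMin hf hmin v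

end PseudoRiemannianMetric

end Literature.Geometry.Lorentzian

end
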